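import Summits.Ventures.HSemireg.Mod4LeadingTermPinCriterion

/-!
# Venture HSemireg — MOD-4 line: the pin-block determinant is AFFINE in the top coefficient `q_{2n−2a}` with NON-ZERO slope —
# at every pin of an even `n` the drop-2 locus is the graph of ONE value of `q_{2n−2a}` over the lower tail coefficients

HONEST FRAMING. Part of the Lean index of the computation cell `pub-hsemireg` (seat w3-mod4-1 gen 15, W3 SPECIAL FIBRES; file of
record `HOME/widen/W3/MOD4-OFFSPLIT-w3mod4.md` §13.31–13.32). `Mod4LeadingTermPinCriterion` decides the middle entry of a
`ch(O_Z)`-shape row at the pin `t_a` by ONE `k × k` determinant `det B_a(q_n, …, q_{2n−2a})` (`k = n − 2a`); THIS FILE shows that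
determinant is affine in the top coefficient with a non-zero slope, so for every `q_n ≠ 0` and every lower tail `q_{n+1}, …, q_{2n−2a−1}`
EXACTLY ONE value of `q_{2n−2a}` gives drop `2` (and every other value drop `1`). ELEMENTARY LINEAR ALGEBRA over a field ONLY: no
abelian variety, no sheaf, no Ext group, no semiregularity map; nothing here says that HC / HC_CM / HC_AV holds; no Literature fact is
declared; NO definition is introduced.

WHAT IS PROVED:
* **`det_updateRow_zero_corner`** — for an «upper Hessenberg» `(k+1) × (k+1)` matrix `B` (`B_{s+1,t} = 0` for `t < s`), adding
  `c` to the top-right corner `B_{0,k}` changes `det B` by `c · (−1)^k · Π_{s<k} B_{s+1,s}` (Laplace along row `0`; the surviving minor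
  is triangular with the sub-diagonal of `B` on its diagonal);
* **`existsUnique_corner_det_eq_zero`** — if those sub-diagonal entries are non-zero, exactly one corner value makes `det` vanish;
* **`pinBlock_update_top`** — for a leading shape (`q_m = 0`, `m < n`; `n = a + (k+1) + a`) replacing `q_{n+k+1} = q_{2n−2a}` by `x`
  changes the pin block of `T_f − μ_a` only in its top-right corner, by `(x − q_{2n−2a})·(−1)^{a+k+1} C(n,a+k+1)`;
* **`pinBlock_subdiag_ne_zero`**, **`pinBlock_hessenberg`** — the block's sub-diagonal carries the non-zero pivots, and the block is
  upper Hessenberg;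
* **`existsUnique_top_coeff_det_pinBlock_eq_zero`** — EXACTLY ONE `x` with `det B_a(q[q_{2n−2a} := x]) = 0`;
* **`existsUnique_top_coeff_drop_two`** — for even `n`: EXACTLY ONE `x` with `dim ker(M_f(q[q_{2n−2a} := x]) − t_a) = 2`
  (`t_a = (−1)ⁿ C(n,a)² q_n²` does not depend on `x`).
So at every non-self-dual pin of every even `n` BOTH cases of the pin criterion occur, for every lower tail. Everything PROVED,
0 sorry. Namespace `Summit.Ventures.HSemireg.Mod4`. References: [BourbakiAlgebre1a3] Ch. III §8 (Laplace expansion, triangular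
determinants); [BuchweitzFlenner2008HH] Prop. 6.4.4 (why these matrices).
-/

namespace Summit.Ventures.HSemireg.Mod4

open Finset Matrix

variable {K : Type*} [Field K]

/-! ### Upper Hessenberg matrices: the determinant is affine in the top-right corner -/

/-- **Laplace along row `0`:** for `B` with `B_{s+1,t} = 0` whenever `t < s`, adding `c` to the corner `B_{0,k}` adds
`c · (−1)^k · Π_{s<k} B_{s+1,s}` to the determinant. [cite: BourbakiAlgebre1a3, Ch. III §8] -/
theorem det_updateRow_zero_corner {k : ℕ} (B : Matrix (Fin (k + 1)) (Fin (k + 1)) K)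
    (hB : ∀ (s : Fin k) (t : Fin (k + 1)), (t : ℕ) < (s : ℕ) → B s.succ t = 0) (c : K) :
    (B.updateRow 0 (B 0 + c • Pi.single (Fin.last k) 1)).det =
      B.det + c * ((-1 : K) ^ k * ∏ s : Fin k, B s.succ (Fin.castSucc s)) := by
  rw [Matrix.det_updateRow_add, Matrix.updateRow_eq_self, Matrix.det_updateRow_smul]
  congr 2
  rw [Matrix.det_succ_row_zero, Finset.sum_eq_single (Fin.last k)]
  · rw [Matrix.updateRow_self, Pi.single_eq_same, mul_one, Fin.val_last]
    congr 1
    have htri : (Matrix.submatrix (B.updateRow 0 (Pi.single (Fin.last k) (1 : K))) Fin.succ (Fin.last k).succAbove).BlockTriangular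
        id := by
      intro s t hst
      rw [Matrix.submatrix_apply, Fin.succAbove_last, Matrix.updateRow_ne (Fin.succ_ne_zero s)]
      exact hB s _ (by simpa using hst)
    rw [Matrix.det_of_upperTriangular htri]
    refine Finset.prod_congr rfl fun s _ => ?_
    rw [Matrix.submatrix_apply, Fin.succAbove_last, Matrix.updateRow_ne (Fin.succ_ne_zero s)]
  · intro j _ hj
    rw [Matrix.updateRow_self, Pi.single_eq_of_ne hj, mul_zero, zero_mul]
  · intro h
    exact absurd (Finset.mem_univ _) h

/-- **exactly one corner value kills the determinant** when the sub-diagonal entries `B_{s+1,s}` are non-zero.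
[cite: BourbakiAlgebre1a3, Ch. III §8] -/
theorem existsUnique_corner_det_eq_zero {k : ℕ} (B : Matrix (Fin (k + 1)) (Fin (k + 1)) K)
    (hB : ∀ (s : Fin k) (t : Fin (k + 1)), (t : ℕ) < (s : ℕ) → B s.succ t = 0)
    (hsub : ∀ s : Fin k, B s.succ (Fin.castSucc s) ≠ 0) :
    ∃! c : K, (B.updateRow 0 (B 0 + c • Pi.single (Fin.last k) 1)).det = 0 := by
  set α : K := (-1 : K) ^ k * ∏ s : Fin k, B s.succ (Fin.castSucc s) with hα
  have hα0 : α ≠ 0 := mul_ne_zero (pow_ne_zero _ (neg_ne_zero.mpr one_ne_zero)) (Finset.prod_ne_zero_iff.mpr fun s _ => hsub s)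
  refine ⟨-B.det / α, ?_, ?_⟩
  · beta_reduce
    rw [det_updateRow_zero_corner B hB, ← hα]
    field_simp
    ring
  · intro c hc
    rw [det_updateRow_zero_corner B hB, ← hα] at hc
    field_simp
    linear_combination hc

/-! ### The pin block of `T_f − μ_a` as a function of the top coefficient `q_{2n−2a}` -/

/-- **the pin block is upper Hessenberg** for a leading shape (`q_m = 0`, `m < n`): `B_{s+1,t} = 0` for `t < s`.
[cite: BourbakiAlgebre1a3, Ch. III §8] -/
theorem pinBlock_hessenberg {n a k : ℕ} (hn : n = a + (k + 1) + a) {q : ℕ → K} (hq0 : ∀ m, m < n → q m = 0) (μ : K)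
    {B : Matrix (Fin (k + 1)) (Fin (k + 1)) K}
    (hB : B = Matrix.of fun r s : Fin (k + 1) =>
      (hankelT n q - μ • (1 : Matrix (Fin (n + 1)) (Fin (n + 1)) K)) ⟨a + r, by omega⟩ ⟨a + 1 + s, by omega⟩)
    (s : Fin k) (t : Fin (k + 1)) (hts : (t : ℕ) < (s : ℕ)) : B s.succ t = 0 := by
  rw [hB, Matrix.of_apply]
  exact blockTriangular_hankelT_leading_sub hq0 μ (show (⟨a + 1 + (t : ℕ), _⟩ : Fin (n + 1)) < ⟨a + (s.succ : ℕ), _⟩ from by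
    rw [Fin.mk_lt_mk, Fin.val_succ]; omega)

/-- **the sub-diagonal of the pin block carries the non-zero pivots** `N_{bb}`, `a < b < n − a` (`q_n ≠ 0`, `n = a + (k+1) + a` even,
`μ = μ_a`). [cite: BourbakiAlgebre1a3, Ch. III §8] -/
theorem pinBlock_subdiag_ne_zero [CharZero K] {n a k : ℕ} (hn : n = a + (k + 1) + a) (heven : Even n) {q : ℕ → K}
    (hqn : q n ≠ 0) {μ : K} (hμ : μ = (-1 : K) ^ a * (n.choose a : K) * q n) {B : Matrix (Fin (k + 1)) (Fin (k + 1)) K}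
    (hB : B = Matrix.of fun r s : Fin (k + 1) =>
      (hankelT n q - μ • (1 : Matrix (Fin (n + 1)) (Fin (n + 1)) K)) ⟨a + r, by omega⟩ ⟨a + 1 + s, by omega⟩)
    (s : Fin k) : B s.succ (Fin.castSucc s) ≠ 0 := by
  have hs := s.isLt
  obtain ⟨-, -, hpiv⟩ := hankelT_sub_pin_diag hn heven hqn hμ
  rw [hB, Matrix.of_apply]
  have h : (⟨a + 1 + (Fin.castSucc s : ℕ), by simp; omega⟩ : Fin (n + 1)) = ⟨a + (s.succ : ℕ), by simp; omega⟩ :=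
    Fin.ext (by simp only [Fin.val_castSucc, Fin.val_succ]; omega)
  rw [h]
  exact hpiv _ (by simp only [Fin.val_succ]; omega) (by simp only [Fin.val_succ]; omega)

/-- **replacing the top coefficient `q_{2n−2a}` moves only the corner of the pin block:** with `n = a + (k+1) + a` and
`q' = q[n + k + 1 ↦ x]`, the pin block of `T_f(q') − μ` is that of `T_f(q) − μ` with `(x − q_{n+k+1})·(−1)^{a+k+1} C(n,a+k+1)` added
to the entry `(0, k)`. [cite: BourbakiAlgebre1a3, Ch. III §8] -/
theorem pinBlock_update_top {n a k : ℕ} (hn : n = a + (k + 1) + a) (q : ℕ → K) (μ x : K)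
    {B B' : Matrix (Fin (k + 1)) (Fin (k + 1)) K}
    (hB : B = Matrix.of fun r s : Fin (k + 1) =>
      (hankelT n q - μ • (1 : Matrix (Fin (n + 1)) (Fin (n + 1)) K)) ⟨a + r, by omega⟩ ⟨a + 1 + s, by omega⟩)
    (hB' : B' = Matrix.of fun r s : Fin (k + 1) =>
      (hankelT n (Function.update q (n + k + 1) x) - μ • (1 : Matrix (Fin (n + 1)) (Fin (n + 1)) K)) ⟨a + r, by omega⟩
        ⟨a + 1 + s, by omega⟩) :
    B' = B.updateRow 0 (B 0 + ((x - q (n + k + 1)) * ((-1 : K) ^ (a + k + 1) * (n.choose (a + k + 1) : K))) •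
      Pi.single (Fin.last k) 1) := by
  ext r s
  have hr := r.isLt
  have hs := s.isLt
  rw [pinBlock_apply hn _ μ hB' r s, Matrix.updateRow_apply]
  by_cases hr0 : r = 0
  · rw [if_pos hr0, Pi.add_apply, pinBlock_apply hn q μ hB 0 s, Pi.smul_apply, hr0]
    by_cases hsk : s = Fin.last k
    · rw [hsk, Pi.single_eq_same, Fin.val_last, Fin.val_zero, show n + 1 + k - 0 = n + k + 1 by omega, Function.update_self,
        show a + 1 + k = a + k + 1 by omega, smul_eq_mul, mul_one]
      ring
    · have hsk' : (s : ℕ) ≠ k := fun h => hsk (Fin.ext (by rw [h, Fin.val_last]))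
      rw [Pi.single_eq_of_ne hsk, smul_zero, add_zero, Fin.val_zero,
        Function.update_of_ne (show n + 1 + (s : ℕ) - 0 ≠ n + k + 1 by omega)]
  · rw [if_neg hr0, pinBlock_apply hn q μ hB r s]
    have hr0' : (r : ℕ) ≠ 0 := fun h => hr0 (Fin.ext h)
    rw [Function.update_of_ne (show n + 1 + (s : ℕ) - (r : ℕ) ≠ n + k + 1 by omega)]

/-- **EXACTLY ONE top coefficient kills the pin-block determinant:** for a leading shape (`q_m = 0`, `m < n`), `q_n ≠ 0`,
`n = a + (k+1) + a` even, `μ = μ_a`: there is exactly one `x` such that the pin block of `T_f(q[q_{n+k+1} := x]) − μ_a` is singular.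
[cite: BourbakiAlgebre1a3, Ch. III §8] -/
theorem existsUnique_top_coeff_det_pinBlock_eq_zero [CharZero K] {n a k : ℕ} (hn : n = a + (k + 1) + a) (heven : Even n)
    {q : ℕ → K} (hq0 : ∀ m, m < n → q m = 0) (hqn : q n ≠ 0) {μ : K} (hμ : μ = (-1 : K) ^ a * (n.choose a : K) * q n)
    {B' : K → Matrix (Fin (k + 1)) (Fin (k + 1)) K}
    (hB' : ∀ x, B' x = Matrix.of fun r s : Fin (k + 1) =>
      (hankelT n (Function.update q (n + k + 1) x) - μ • (1 : Matrix (Fin (n + 1)) (Fin (n + 1)) K)) ⟨a + r, by omega⟩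
        ⟨a + 1 + s, by omega⟩) :
    ∃! x : K, (B' x).det = 0 := by
  set B : Matrix (Fin (k + 1)) (Fin (k + 1)) K := Matrix.of fun r s : Fin (k + 1) =>
      (hankelT n q - μ • (1 : Matrix (Fin (n + 1)) (Fin (n + 1)) K)) ⟨a + r, by omega⟩ ⟨a + 1 + s, by omega⟩ with hB
  set γ : K := (-1 : K) ^ (a + k + 1) * (n.choose (a + k + 1) : K) with hγ
  have hγ0 : γ ≠ 0 :=
    mul_ne_zero (pow_ne_zero _ (neg_ne_zero.mpr one_ne_zero)) (Nat.cast_ne_zero.mpr (Nat.choose_pos (by omega)).ne')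
  have hupd : ∀ x, B' x = B.updateRow 0 (B 0 + ((x - q (n + k + 1)) * γ) • Pi.single (Fin.last k) 1) :=
    fun x => pinBlock_update_top hn q μ x hB (hB' x)
  obtain ⟨c, hc, huniq⟩ := existsUnique_corner_det_eq_zero B (pinBlock_hessenberg hn hq0 μ hB)
    (pinBlock_subdiag_ne_zero hn heven hqn hμ hB)
  refine ⟨c / γ + q (n + k + 1), ?_, ?_⟩
  · beta_reduce
    rw [hupd, show (c / γ + q (n + k + 1) - q (n + k + 1)) * γ = c by field_simp; ring]
    exact hc
  · intro x hx
    rw [hupd] at hx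
    have h := huniq _ hx
    rw [← h]
    field_simp
    ring

/-- **EXACTLY ONE top coefficient gives drop `2` — every even `n`, every pin `a < n/2`, every lower tail:** for a leading shape
(`q_m = 0`, `m < n`), `q_n ≠ 0`, `n = a + (k+1) + a` even and `t = (−1)ⁿ C(n,a)² q_n²`, there is exactly one value `x` of the
coefficient `q_{2n−2a} = q_{n+k+1}` with `dim ker(M_f(q[q_{n+k+1} := x]) − t) = 2`; for every other value the dimension is `1`
(`Mod4LeadingTermPinCriterion`). [cite: BourbakiAlgebre1a3, Ch. III §8] [cite: BuchweitzFlenner2008HH, Prop. 6.4.4] -/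
theorem existsUnique_top_coeff_drop_two [CharZero K] {n a k : ℕ} (hn : n = a + (k + 1) + a) (heven : Even n)
    {q : ℕ → K} (hq0 : ∀ m, m < n → q m = 0) (hqn : q n ≠ 0) {t : K}
    (ht : t = (-1 : K) ^ n * ((n.choose a : K) * (n.choose a : K)) * (q n * q n)) :
    ∃! x : K, Module.finrank K ↥(LinearMap.ker
      (Matrix.toLin' (middleM n (Function.update q (n + k + 1) x)) - t • LinearMap.id)) = 2 := by
  set μ : K := (-1 : K) ^ a * (n.choose a : K) * q n with hμ
  let B' : K → Matrix (Fin (k + 1)) (Fin (k + 1)) K := fun x => Matrix.of fun r s : Fin (k + 1) =>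
      (hankelT n (Function.update q (n + k + 1) x) - μ • (1 : Matrix (Fin (n + 1)) (Fin (n + 1)) K)) ⟨a + r, by omega⟩
        ⟨a + 1 + s, by omega⟩
  have hq' : ∀ x, (∀ m, m < n → Function.update q (n + k + 1) x m = 0) ∧ Function.update q (n + k + 1) x n = q n := by
    intro x
    refine ⟨fun m hm => ?_, Function.update_of_ne (by omega) _ _⟩
    rw [Function.update_of_ne (by omega)]
    exact hq0 m hm
  have hiff : ∀ x, Module.finrank K ↥(LinearMap.ker
      (Matrix.toLin' (middleM n (Function.update q (n + k + 1) x)) - t • LinearMap.id)) = 2 ↔ (B' x).det = 0 := by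
    intro x
    obtain ⟨hq0x, hqnx⟩ := hq' x
    exact finrank_ker_middleM_leading_pin_eq_two_iff hn heven hq0x (by rw [hqnx]; exact hqn) (μ := μ) (by rw [hqnx]) (by rw [hqnx, ht])
      rfl
  obtain ⟨x, hx, huniq⟩ := existsUnique_top_coeff_det_pinBlock_eq_zero hn heven hq0 hqn hμ (B' := B') (fun x => rfl)
  exact ⟨x, (hiff x).mpr hx, fun y hy => huniq y ((hiff y).mp hy)⟩

end Summit.Ventures.HSemireg.Mod4
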